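import Literature.Analysis.FluidPDE.TaoAveragedCascadeHolds

/-!
# Crux `PerpetualPump.AveragedTypeIBlowup` (stmt-NavierStokesRegularity-1835), line `Sketch`:
# stub `transfer` — a cascade-level Type-I blow-up is an averaged Type-I blow-up (Tao's Theorem 3.2)

The crux asks for a symmetric averaging datum `𝒜` with cancellation (Tao 2016, (1.12)–(1.16),
`Tao2016.AveragingDatum`), a Schwartz divergence-free datum `u₀`, a time `T > 0` and an
`H¹⁰_df`-mild solution `u` of the averaged Navier–Stokes equation on `[0,T)` at the Type-I rate
`‖u(t)‖_∞ ≤ M (T-t)^{-1/2}` with NO mild extension past `T`. The line `Sketch` builds such an object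
for a symmetric cancelling LOCAL CASCADE EQUATION (Tao Def. 3.1, (3.2)–(3.3)) at arbitrarily fine
dyadic parameter `ε₀`, and this file is the last, purely logical step: the transfer through Tao's
**Theorem 3.2** (every local cascade operator with `ε₀` below an absolute threshold `ε₁` is an averaged
Euler operator), which is a THEOREM of the tree (`Tao2016.localCascade_isAveraged_holds`).

* `stub_transfer` — given, for every threshold `ε₁ > 0`, a dyadic parameter `0 < ε₀ ≤ ε₁`, a symmetric
  local cascade form `C` with cancellation, a Schwartz divergence-free `u₀`, `S > 0` and a
  non-extendable Type-I-rate mild solution of `∂ₜu = Δu + C(u,u)` on `[0,S)`, the crux statement holds: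
  feed the `ε₁` of Theorem 3.2 to the hypothesis, get `𝒜` with `⟨B̃_𝒜(u,v), w⟩ = ⟨C(u,v), w⟩` on
  `H¹⁰_df × H¹⁰_df × (H¹⁰_df ⊗ ℂ)`; symmetry and cancellation transfer verbatim
  (`MemH10df.memH10dfC`); mild solutions and mild extensions of `C` and of `𝒜` on initial segments
  `[0,R)` correspond both ways, because the Duhamel identity (1.15)/(3.3) only tests the form on
  `(v(s), v(s), e^{(t-s)Δ}w)` with `v(s), w ∈ H¹⁰_df`, `0 ≤ s ≤ t < R`, and `e^{τΔ}` maps `H¹⁰_df` into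
  `H¹⁰_df ⊗ ℂ` (`MemH10dfC.heat`) — the gluing step of Tao's "Theorem 1.5 ⇐ Theorems 3.2 + 3.3"
  (p. 14, in tree as `averagedNS_blowup_of_cascade`); the rate conjunct is untouched.

The gluing is kept local to the proof: its named, reusable form (forms agreeing on
`H¹⁰_df × H¹⁰_df × (H¹⁰_df ⊗ ℂ)` have the same mild solutions on initial segments) is already the landed
`Summit.NavierStokesRegularity.NavierStokesRegularity.Theorems.Thesis.Negative.isMildSolutionFor_congr`
(`Theorems/Thesis/Negative/CascadeReduction.lean`), where the same argument is read as `¬ Thesis`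
(`not_thesis_of_cascade`); here the conclusion is the crux statement itself, positively, spelled out
over the Literature vocabulary only (the statement is definitionally the body of the route decl
`Theses.PerpetualPump.AveragedTypeIBlowup`, which this file deliberately does not import: the line's
skeleton concludes the route decl by name from `stub_transfer`). Nothing here closes the item
(`--supports`); no statement of the route changes.

## References

* T. Tao, *Finite time blowup for an averaged three-dimensional Navier–Stokes equation*, J. Amer.
  Math. Soc. 29 (2016), 601–674 = arXiv:1402.0290v3, §3 p. 14, Def. 3.1, (3.2)–(3.3), Thm. 3.2.
  [`Tao2016AveragedNS`]
-/

noncomputable section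

-- the summit namespace `…NavierStokesRegularity.NavierStokesRegularity…` is the tree convention
set_option linter.dupNamespace false

open MeasureTheory Set Filter Topology
open scoped ENNReal
open Literature.Analysis.FluidPDE Literature.Analysis.FluidPDE.Tao2016

namespace Summit.NavierStokesRegularity.NavierStokesRegularity.Theorems.PerpetualPumpAveragedTypeIBlowup

/-- Local notation for `ℝ³` (file-local, as in `Literature/Analysis/FluidPDE/TaoAveragedCascade.lean`
and the line's skeleton; the registered stub signature is spelled with it). -/
local notation "ℝ³" => EuclideanSpace ℝ (Fin 3)

/-- **Stub `transfer` (line `Sketch` of crux `AveragedTypeIBlowup`).** A Type-I-rate, non-extendable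
`H¹⁰_df`-mild solution of a symmetric cancelling LOCAL CASCADE equation (Tao Def. 3.1, (3.2)–(3.3)),
available at arbitrarily fine dyadic parameter `ε₀`, gives a Type-I-rate, non-extendable `H¹⁰_df`-mild
solution of an averaged Navier–Stokes equation for a symmetric averaging datum with cancellation: by
Theorem 3.2 (`localCascade_isAveraged_holds`, whose smallness threshold `ε₁` is fed to the hypothesis)
the cascade form `C` is `⟨B̃_𝒜(·,·), ·⟩` on `H¹⁰_df × H¹⁰_df × (H¹⁰_df ⊗ ℂ)` for some averaging datum
`𝒜`; symmetry and cancellation transfer verbatim, mild solutions and mild extensions on initial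
segments `[0,R)` correspond both ways (the Duhamel identity only tests the form on
`(v(s), v(s), e^{(t-s)Δ}w)` with `v(s), w ∈ H¹⁰_df`, `0 ≤ s ≤ t`, and `e^{τΔ} H¹⁰_df ⊆ H¹⁰_df ⊗ ℂ`),
and the rate conjunct is untouched. [cite: Tao2016AveragedNS, Thm. 3.2 and §3 p. 14] -/
theorem stub_transfer :
    (∀ ε₁ : ℝ, 0 < ε₁ → ∃ ε₀ : ℝ, 0 < ε₀ ∧ ε₀ ≤ ε₁ ∧
      ∃ C : L2C → L2C → L2C → ℂ, IsLocalCascadeForm ε₀ C ∧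
        (∀ u v w, MemH10df u → MemH10df v → MemH10df w → C u v w = C v u w) ∧
        (∀ u, MemH10df u → C u u u = 0) ∧
        ∃ u₀ : SchwartzMap ℝ³ ℝ³, VectorCalculus.IsDivFree ⇑u₀ ∧ ∃ S : ℝ, 0 < S ∧ ∃ u : ℝ → L2C,
          IsMildSolutionFor C (schwartzL2 u₀) (Ico 0 S) u ∧
          (∃ M : ℝ, ∀ t ∈ Ico 0 S, eLpNorm (u t) ⊤ volume ≤ ENNReal.ofReal (M / Real.sqrt (S - t))) ∧
          ¬ ∃ S' : ℝ, S < S' ∧ ∃ v : ℝ → L2C,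
            IsMildSolutionFor C (schwartzL2 u₀) (Ico 0 S') v ∧ ∀ t ∈ Ico 0 S, v t = u t) →
    ∃ 𝒜 : AveragingDatum, 𝒜.IsSymmetric ∧ 𝒜.HasCancellation ∧
      ∃ u₀ : SchwartzMap ℝ³ ℝ³, VectorCalculus.IsDivFree ⇑u₀ ∧ ∃ T : ℝ, 0 < T ∧ ∃ u : ℝ → L2C,
        𝒜.IsMildSolution (schwartzL2 u₀) (Ico 0 T) u ∧
        (∃ M : ℝ, ∀ t ∈ Ico 0 T, eLpNorm (u t) ⊤ volume ≤ ENNReal.ofReal (M / Real.sqrt (T - t))) ∧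
        ¬ ∃ T' : ℝ, T < T' ∧ ∃ v : ℝ → L2C,
          𝒜.IsMildSolution (schwartzL2 u₀) (Ico 0 T') v ∧ ∀ t ∈ Ico 0 T, v t = u t := by
  intro h
  obtain ⟨ε₁, hε₁, h32⟩ := localCascade_isAveraged_holds
  obtain ⟨ε₀, hε₀, hle, C, hC, hsymm, hcanc, u₀, hdiv, S, hS, u, hmild, hrate, hno⟩ := h ε₁ hε₁
  obtain ⟨𝒜, h𝒜⟩ := h32 ε₀ hε₀ hle C hC
  -- gluing: forms agreeing on `H¹⁰_df × H¹⁰_df × (H¹⁰_df ⊗ ℂ)` have the same mild solutions on `[0,R)`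
  have key : ∀ {G₁ G₂ : L2C → L2C → L2C → ℂ},
      (∀ a b c, MemH10df a → MemH10df b → MemH10dfC c → G₁ a b c = G₂ a b c) →
      ∀ {R : ℝ} {v : ℝ → L2C}, IsMildSolutionFor G₁ (schwartzL2 u₀) (Ico 0 R) v →
        IsMildSolutionFor G₂ (schwartzL2 u₀) (Ico 0 R) v := by
    intro G₁ G₂ hG R v hv
    refine ⟨hv.1, hv.2.1, fun t ht w hw => ?_⟩
    rw [hv.2.2 t ht w hw]
    congr 1
    refine intervalIntegral.integral_congr fun s hs => ?_
    rw [uIcc_of_le ht.1] at hs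
    have hsR : s ∈ Ico 0 R := ⟨hs.1, hs.2.trans_lt ht.2⟩
    exact hG _ _ _ (hv.1 s hsR) (hv.1 s hsR) (hw.memH10dfC.heat _)
  have h𝒜' : ∀ a b c, MemH10df a → MemH10df b → MemH10dfC c → C a b c = 𝒜.form a b c :=
    fun a b c ha hb hc => (h𝒜 a b c ha hb hc).symm
  refine ⟨𝒜, fun a b c ha hb hc => ?_, fun a ha => ?_, u₀, hdiv, S, hS, u, key h𝒜' hmild, hrate, ?_⟩
  · -- symmetry transfers verbatim on `H¹⁰_df`
    rw [h𝒜 a b c ha hb hc.memH10dfC, h𝒜 b a c hb ha hc.memH10dfC]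
    exact hsymm a b c ha hb hc
  · -- cancellation transfers verbatim on `H¹⁰_df`
    rw [h𝒜 a a a ha ha ha.memH10dfC]
    exact hcanc a ha
  · -- an `𝒜`-mild extension past `S` would be a `C`-mild extension past `S`
    rintro ⟨S', hSS', v, hv, hvu⟩
    exact hno ⟨S', hSS', v, key h𝒜 hv, hvu⟩

end Summit.NavierStokesRegularity.NavierStokesRegularity.Theorems.PerpetualPumpAveragedTypeIBlowup

end
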